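import Literature.Analysis.FluidPDE.HardSpherePhaseSpace
import Literature.MathematicalPhysics.KineticTheory.HardSphereEuler
import HarnessLib

/-!
# The `|g|²`-weighted collision-difference mark `ψ_T` at contact is the collisional change of
# `Σ ⟪v, T v⟫` (line `Sketch` v8, crux `LambertianContactSwap.ContactAngleEquidistribution`,
# stmt-AtomisticToContinuum-12097)

Helper file (`--supports stmt-AtomisticToContinuum-12097`, registered stub `stub_psiT_hit`).
For a continuous linear map `T : ℝ³ →L[ℝ] ℝ³` and the quadratic velocity observable `q(v) = ⟪v, T v⟫`,
put `Dq_T(v, w, ω) = q(v − ⟪v − w, ω⟫ ω) + q(w + ⟪v − w, ω⟫ ω) − q(v) − q(w)` and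
`ψ_T(s, x, v, w, n) = Dq_T(v, w, n̂) / (12 ‖v − w‖²)`, `n̂ = ‖n‖⁻¹ • n`. On a configuration `y` of `N + 1`
hard spheres on the torus with the pair `(i, j)` at contact, `‖sepVec(xᵢ, xⱼ)‖ = e > 0`, the contact normal
`ω = e⁻¹ • sepVec(xᵢ, xⱼ)` is a unit vector, the elementary reflection `(v − ⟪v − w, ω⟫ ω, w + ⟪v − w, ω⟫ ω)`
coincides with the reflection law `reflectVel (sepVec(xᵢ, xⱼ)) (v, w)` used by `collidePair` (the law is
homogeneous of degree `0` in the normal, `reflectVel_smul`), and therefore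
`‖vᵢ − vⱼ‖² · ψ_T(s, x, vᵢ, vⱼ, ω) = (1/12) · (q(vᵢ') + q(vⱼ') − q(vᵢ) − q(vⱼ))`, where `(vᵢ', vⱼ')` are the
post-collisional velocities of `collidePair`. In the degenerate case `vᵢ = vⱼ` both sides vanish (the
reflection of a pair of equal velocities is the identity).

References: folklore (Mathlib: `norm_smul`, `inner_smul_right`, `smul_smul`; tree:
`Literature.Analysis.FluidPDE.collidePair_apply_left/right`, `reflectVel_smul`).
-/

noncomputable section

open scoped RealInnerProductSpace

namespace Summit.AtomisticToContinuum.HydrodynamicLimit.Theorems.ContactAngleEquidistributionSketch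

open Literature.Analysis.FluidPDE Literature.MathematicalPhysics.KineticTheory

/-- Scalar bookkeeping: `a · ((12 a)⁻¹ · B) = B / 12` provided `B = 0` whenever `a = 0`
(Lean's total inverse, `0⁻¹ = 0`). [folklore] -/
private theorem mul_inv_twelve_mul_aux {a B : ℝ} (h : a = 0 → B = 0) :
    a * ((12 * a)⁻¹ * B) = 12⁻¹ * B := by
  by_cases ha : a = 0
  · simp [ha, h ha]
  · rw [mul_inv, ← mul_assoc, ← mul_assoc, mul_comm a 12⁻¹, mul_assoc 12⁻¹, mul_inv_cancel₀ ha,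
      mul_one]

/-- On a configuration of the torus with the pair `(i, j)` at contact (`‖sepVec(xᵢ, xⱼ)‖ = e > 0`), the
`‖vᵢ − vⱼ‖²`-weighted mark `ψ_T` read at the contact normal `ω = e⁻¹ • sepVec(xᵢ, xⱼ)` is the collisional
change of `Σ ⟪v, T v⟫` over the pair divided by `12`: `collidePair` reflects the pair's velocities along
`sepVec` (`collidePair_apply_left/right`, `reflectVel`), and the reflection law is homogeneous of degree `0`
in the normal (`reflectVel_smul`). [folklore] -/
theorem stub_psiT_hit (T : V3 →L[ℝ] V3) {N : ℕ} {e : ℝ} (he : 0 < e)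
    (y : Config (N + 1) (Fin 3) T3) {i j : Fin (N + 1)} (hij : i ≠ j)
    (hcontact : ‖(Torus.geometry (Fin 3)).sepVec (y i).1 (y j).1‖ = e) (s : ℝ) (x : T3) :
    let refl : V3 → V3 × V3 → V3 × V3 := fun n p =>
      (p.1 - ⟪p.1 - p.2, n⟫ • n, p.2 + ⟪p.1 - p.2, n⟫ • n)
    let Dq : V3 → V3 → V3 → ℝ := fun v w n =>
      ⟪(refl n (v, w)).1, T (refl n (v, w)).1⟫ + ⟪(refl n (v, w)).2, T (refl n (v, w)).2⟫ -
        ⟪v, T v⟫ - ⟪w, T w⟫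
    let ψ : ℝ → T3 → V3 → V3 → V3 → ℝ := fun _ _ v w n =>
      (12 * ‖v - w‖ ^ 2)⁻¹ * Dq v w (‖n‖⁻¹ • n)
    ‖(y i).2 - (y j).2‖ ^ 2 * ψ s x (y i).2 (y j).2 (e⁻¹ • (Torus.geometry (Fin 3)).sepVec (y i).1 (y j).1) =
      12⁻¹ * (⟪(collidePair (Torus.geometry (Fin 3)) i j y i).2, T (collidePair (Torus.geometry (Fin 3)) i j y i).2⟫ +
        ⟪(collidePair (Torus.geometry (Fin 3)) i j y j).2, T (collidePair (Torus.geometry (Fin 3)) i j y j).2⟫ -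
        ⟪(y i).2, T (y i).2⟫ - ⟪(y j).2, T (y j).2⟫) := by
  intro refl Dq ψ
  -- the contact normal `ω = e⁻¹ • n`, `n = sepVec(xᵢ, xⱼ)`, is a unit vector
  have hnorm : ‖e⁻¹ • (Torus.geometry (Fin 3)).sepVec (y i).1 (y j).1‖ = 1 := by
    rw [norm_smul, Real.norm_eq_abs, abs_inv, abs_of_pos he, hcontact, inv_mul_cancel₀ he.ne']
  -- the elementary reflection at the unit normal is the reflection law along `n`
  have hrefl : ∀ v w : V3,
      refl (e⁻¹ • (Torus.geometry (Fin 3)).sepVec (y i).1 (y j).1) (v, w) =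
        reflectVel ((Torus.geometry (Fin 3)).sepVec (y i).1 (y j).1) (v, w) := by
    intro v w
    rw [← reflectVel_smul (inv_ne_zero he.ne') ((Torus.geometry (Fin 3)).sepVec (y i).1 (y j).1)]
    simp only [refl, reflectVel, hnorm, one_pow, div_one]
  -- unfold the mark at the unit normal and read the post-collisional velocities off `collidePair`
  have hψ : ∀ v w : V3,
      ψ s x v w (e⁻¹ • (Torus.geometry (Fin 3)).sepVec (y i).1 (y j).1) =
        (12 * ‖v - w‖ ^ 2)⁻¹ *
          (⟪(reflectVel ((Torus.geometry (Fin 3)).sepVec (y i).1 (y j).1) (v, w)).1,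
              T (reflectVel ((Torus.geometry (Fin 3)).sepVec (y i).1 (y j).1) (v, w)).1⟫ +
            ⟪(reflectVel ((Torus.geometry (Fin 3)).sepVec (y i).1 (y j).1) (v, w)).2,
              T (reflectVel ((Torus.geometry (Fin 3)).sepVec (y i).1 (y j).1) (v, w)).2⟫ -
            ⟪v, T v⟫ - ⟪w, T w⟫) := by
    intro v w
    simp only [ψ, Dq, hnorm, inv_one, one_smul, hrefl]
  rw [hψ, collidePair_apply_left hij, collidePair_apply_right]
  -- `‖g‖² · (12 ‖g‖²)⁻¹ · B = B / 12`, the degenerate case `g = 0` having `B = 0`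
  refine mul_inv_twelve_mul_aux fun h0 => ?_
  have hvw : (y i).2 = (y j).2 :=
    sub_eq_zero.1 (norm_eq_zero.1 ((pow_eq_zero_iff two_ne_zero).1 h0))
  simp [reflectVel, hvw]

end Summit.AtomisticToContinuum.HydrodynamicLimit.Theorems.ContactAngleEquidistributionSketch
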